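import Literature.NumberTheory.Automorphic.Liu2021.ThetaLiftFromLineCharacters
import HarnessLib

/-!
# Liu 2021, Corollary B.6 (1) at `(dim W, dim V) = (1, N)` — «the space `Θ^W_{(μ,ν),V}(V_π)` is an irreducible representation» [Wu2013, Thm. 5.3] —
# as a PREDICATE on the tree's theta-road data: IRREDUCIBILITY OF THE CLOSED THETA SPAN of a character `ξ` of the line `U(⟨a⟩)` in `L²([U(H)])`

Topic `NumberTheory/Automorphic/Liu2021`; namespace `Literature.NumberTheory.Automorphic.Liu2021`.  STATEMENT ONLY (one `def … : Prop` with body + its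
`_iff` unfolding; no `sorry`, no instance, no notation, nothing asserted — a PREDICATE of the frame ∕ line ∕ character data, closed over the CM curve frames
ONLY by its consumer, the organ (I′) `ThetaSpaceIrreducible₂` of `Summits/…/Cruxes/HLiu418/Lines/F0_P6LD_StubS1FactsThetaRoad.lean`, cell hodgecm-mathlib,
line LD1).  Vocabulary = ★ `ThetaLiftFromLineMeets` ∕ ★ `ThetaLiftFromLineCharacters` (`lineThetaKernelDatum`, `thetaLiftFun`, `charCM`, `normal_range_toAdelic_JW`),
★ `AutomorphicSpectrum` (`rightRegular`, `IsAutomorphicMeasure`), ★ `HilbertRepSpectrum` (`ContRepresentation.ClosedSubrep`, `IsTopIrreducible`).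

THE PREDICATE.  Data: a CM field `L`, `H ∈ M_N(L)`, a real non-zero diagonal `dV` (the Gram matrix `diag dV` of `V`), a reindexing `e₁`, a homomorphism
`ιA : U(H)(𝔸_{L⁺}) →* U(diag dV)(𝔸_{L⁺})` (in the consumer: the adelic frame transport `k ↦ g_𝔸⁻¹ k g_𝔸` of a rational isometry `(L^N, t·H) ≅ (L^N, diag dV)`),
`[U(diag dV)]` compact, an automorphic measure `μA` on `[U(H)]`, a conjugate-symplectic `μ` (the splitting character, [Liu2021, App. D §D.1 Step 2]), a line
`a ∈ (L⁺)ˣ` (`W = ⟨a⟩`), and a continuous unitary character `ξ` of the compact abelian group `[U(⟨a⟩)] = U(⟨a⟩)(L⁺)\U(⟨a⟩)(𝔸_{L⁺})`.  Let `S ⊆ L²([U(H)], μA)` be the set of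
ALL `(a, ξ)`-THETA CLASSES `[x ↦ Θ̃_Ψ(ξ)(ιA x)]` (every Weil-majorant witness `hρ`, every finite `U(⟨a⟩)(𝔸)`-invariant measure `μW` on `[U(⟨a⟩)]`, every
Schwartz–Bruhat `Ψ`; the theta lift ★ `Weil1964.ThetaKernelDatum.thetaLiftFun` of the datum ★ `lineThetaKernelDatum`), and `Q̄` the topological closure of
its linear span.  `ThetaLiftFromLineIrreducible …` SAYS: every closed `R`-invariant subspace `Q` of the right regular representation whose carrier is `Q̄` is
either `0` or TOPOLOGICALLY IRREDUCIBLE.  (That `Q̄` IS the carrier of a closed invariant subspace is proved in the tree, ★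
`Summits/…/Theorems/F0LD1CharThetaSpaceLeOfIrreducible.exists_closedSubrep_thetaSpan`; the «`= ⊥ ∨`» disjunct keeps the predicate true where the lift of `ξ`
vanishes — epsilon dichotomy.)

PRINT ANCHOR AND SCOPE.  [Liu2021, Cor. B.6 (1), p. 99]: «Let the notation be as above. Suppose that `Θ^W_{(μ,ν),V}(V_π)` is cuspidal. Then (1) The space
`Θ^W_{(μ,ν),V}(V_π)` is an irreducible representation of `U(W)(𝔸_F)` [there: lift `V → W`; read here in the direction `W = ⟨a⟩ → V`, `π_W = ξ` a character of the
compact torus `[U(⟨a⟩)]`] …», proof l. 4339: «the irreducibility follows from [Wu13, Theorem 5.3]» = C. Wu, *Irreducibility of theta lifting for unitary groups*,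
J. Number Theory 133 (2013), Thm. 5.3 (for `σ` cuspidal on `U(W)` with `Θ_V(σ)` cuspidal on `U(V)`, `Θ_V(σ)` is irreducible).  At `(1, N)` with `U(V) = U(H)`
ANISOTROPIC over `L⁺` (the consumer's definiteness clause) every automorphic form on `U(H)` is cuspidal, so the cuspidality proviso is void.  The printed
irreducibility is that of the automorphic realisation (the `(𝔤,K) × G(𝔸_f)`-module of `K`-finite theta functions); the `L²`-CLOSURE phrasing used here follows
from it by [BorelJacquet1979, §4.6] ∕ [GelfandGraevPiatetskiShapiro1969, Ch. 1 §2] (`L²` of the compact quotient `[U(H)]` is a Hilbert direct sum of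
irreducibles with finite multiplicities; closed invariant subspaces of an admissible unitary representation correspond to `(𝔤,K) × G(𝔸_f)`-submodules of its
`K`-finite vectors, and the `K`-finite theta functions are dense in `Q̄`).  Local ingredients of [Wu13]: Howe duality for unitary dual pairs (non-archimedean:
[GanTakeda2016, Thm. 1.2]; rank one: [MVW1987, chap. 3 IV.4], tree ★ `mvw_IV4_rankOne_irreducibleOrZero_holds`), Rallis' inner product ∕ multiplicity preservation
[Rallis1984, §1].  NOT the anchor: [Liu2021, Cor. B.6 (3)] ∕ Prop. D.4 (1) (those are the consumer's letter #73).  Nothing is asserted in this file.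

## References
* [Liu2021] Y. Liu, *Fourier–Jacobi cycles and arithmetic relative trace formula*, Camb. J. Math. 9 (2021) = arXiv:2102.11518: App. B Cor. B.6 (1) and its
  proof (p. 99, l. 4319–4339); proof of Prop. 4.13 Case 1 (p. 48); App. D §D.1.
* [Wu2013] C. Wu, *Irreducibility of theta lifting for unitary groups*, J. Number Theory 133 (2013) 3296–3318, Thm. 5.1, Thm. 5.3.
* [Rallis1984] S. Rallis, *On the Howe duality conjecture*, Compositio Math. 51 (1984) 333–399, §1.
* [BorelJacquet1979] A. Borel, H. Jacquet, *Automorphic forms and automorphic representations*, PSPM 33.1 (1979), §4.6.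
* [GanTakeda2016] W. T. Gan, S. Takeda, *A proof of the Howe duality conjecture*, J. AMS 29 (2016), Thm. 1.2.
* [MVW1987] C. Mœglin, M.-F. Vignéras, J.-L. Waldspurger, LNM 1291 (1987), chap. 3 IV.4.
-/

noncomputable section

open NumberField MeasureTheory IsDedekindDomain
open scoped Matrix ComplexOrder ENNReal
open Literature.NumberTheory.Automorphic Literature.NumberTheory.Automorphic.UnitaryGroup
open Literature.NumberTheory.Automorphic.UnitaryGroup.CotangentForms
open Literature.NumberTheory.Automorphic.IdeleClassGroup
open Literature.NumberTheory.Automorphic.Liu2021.Def411WeilCarriers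
open Literature.NumberTheory.Automorphic.Liu2021.Def411WeilCarriersDoubling
open Literature.NumberTheory.GelbartRogawski1991 Literature.NumberTheory.GelbartRogawski1991.UnitaryDualPair
open Literature.NumberTheory.Weil1964
open Literature.RepresentationTheory.Liu2021
open Literature.RepresentationTheory.CompactGroups

namespace Literature.NumberTheory.Automorphic.Liu2021

variable (L : Type) [Field L] [NumberField L] [IsCMField L] (N : ℕ) (H : Matrix (Fin N) (Fin N) L)
  {n' : ℕ} (e₁ : Fin N × Fin 1 ≃ Fin n') (dV : Fin N → L) (hdV : ∀ i, IsCMField.complexConj L (dV i) = dV i)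
  (hdV0 : ∀ i, dV i ≠ 0)
  (ιA : (adelicGroupData (↥(maximalRealSubfield L)) L (IsCMField.complexConj L) N H).Adelic →* ↥(UnitaryGroup.adelic (↥(maximalRealSubfield L)) L (IsCMField.complexConj L) N (Matrix.diagonal dV)))
  [CompactSpace (↥(UnitaryGroup.adelic (↥(maximalRealSubfield L)) L (IsCMField.complexConj L) N (Matrix.diagonal dV)) ⧸ (UnitaryGroup.toAdelic (↥(maximalRealSubfield L)) L (IsCMField.complexConj L) N (Matrix.diagonal dV)).range)]
  (μA : Measure (adelicGroupData (↥(maximalRealSubfield L)) L (IsCMField.complexConj L) N H).automorphicQuotient) [(adelicGroupData (↥(maximalRealSubfield L)) L (IsCMField.complexConj L) N H).IsAutomorphicMeasure μA]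
  (μ : Literature.NumberTheory.Automorphic.IdeleClassGroup L →ₜ* Circle) (hμ : IsConjugateSymplectic L μ) (a : (↥(maximalRealSubfield L))ˣ)
  (ξ : haveI := normal_range_toAdelic_JW L a
    PontryaginDual (↥(UnitaryGroup.adelic (↥(maximalRealSubfield L)) L (IsCMField.complexConj L) 1 (JW (↥(maximalRealSubfield L)) L a)) ⧸ (UnitaryGroup.toAdelic (↥(maximalRealSubfield L)) L (IsCMField.complexConj L) 1 (JW (↥(maximalRealSubfield L)) L a)).range))

/-- **[Liu2021, Cor. B.6 (1)] ∕ [Wu2013, Thm. 5.3] at `(dim W, dim V) = (1, N)`, as a PREDICATE: «the closed theta span of the character `ξ` of the line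
`U(⟨a⟩)` in `L²([U(H)], μA)` — the topological closure of the span of ALL `(a, ξ)`-theta classes `[x ↦ Θ̃_Ψ(ξ)(ιA x)]` (all Weil-majorant witnesses, all finite
invariant measures on `[U(⟨a⟩)]`, all Schwartz–Bruhat `Ψ`) — is `0` or TOPOLOGICALLY IRREDUCIBLE under the right regular representation»: every closed
`R`-invariant subspace `Q` with that carrier satisfies `Q = ⊥ ∨ IsTopIrreducible Q`.  Print: «the space `Θ^W_{(μ,ν),V}(V_π)` is an irreducible representation»
(Cor. B.6 (1), «irreducibility follows from [Wu13, Theorem 5.3]»); the `L²`-closure phrasing by [BorelJacquet1979, §4.6] (admissibility, finite multiplicities on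
the compact quotient).  Nothing is asserted; the consumer (line LD1, organ (I′)) closes it over the CM curve frames with the pinned transport `ιA`.
[cite: Liu2021, App. B Cor. B.6 (1) and its proof (p. 99, l. 4319–4339)] [cite: Wu2013, Thm. 5.3] [cite: BorelJacquet1979, §4.6] [cite: Rallis1984, §1] -/
def ThetaLiftFromLineIrreducible : Prop :=
  letI : MeasurableSpace (↥(UnitaryGroup.adelic (↥(maximalRealSubfield L)) L (IsCMField.complexConj L) 1 (JW (↥(maximalRealSubfield L)) L a)) ⧸ (UnitaryGroup.toAdelic (↥(maximalRealSubfield L)) L (IsCMField.complexConj L) 1 (JW (↥(maximalRealSubfield L)) L a)).range) := borel _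
  haveI := normal_range_toAdelic_JW L a
  ∀ Q : ContRepresentation.ClosedSubrep ((adelicGroupData (↥(maximalRealSubfield L)) L (IsCMField.complexConj L) N H).rightRegular μA),
    (Q.toSubmodule : Set ((adelicGroupData (↥(maximalRealSubfield L)) L (IsCMField.complexConj L) N H).L2 μA)) = closure (Submodule.span ℂ
        {v : (adelicGroupData (↥(maximalRealSubfield L)) L (IsCMField.complexConj L) N H).L2 μA | ∃ (hρ : HasThetaMajorants fun
      (p : ↥(UnitaryGroup.adelic (↥(maximalRealSubfield L)) L (IsCMField.complexConj L) N (Matrix.diagonal dV)) × ↥(UnitaryGroup.adelic (↥(maximalRealSubfield L)) L (IsCMField.complexConj L) 1 (JW (↥(maximalRealSubfield L)) L a))) (Φ : piSchwartzBruhat (↥(maximalRealSubfield L)) (Fin n')) =>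
        pairRep (↥(maximalRealSubfield L)) L (IsCMField.complexConj L) N 1 e₁ (Matrix.diagonal dV) (JW (↥(maximalRealSubfield L)) L a)
          (chiSplittingLine L e₁ dV hdV hdV0 (toHeckeCharacter L μ) (isUnitary_toHeckeCharacter L μ)
            ((isOscillatorChar_toHeckeCharacter_iff μ).mpr hμ) (TW (↥(maximalRealSubfield L)) a)
            (isUnit_det_TW (↥(maximalRealSubfield L)) a) (JW (↥(maximalRealSubfield L)) L a) (JW_eq (↥(maximalRealSubfield L)) L a))
          p Φ)
        (μW : Measure (↥(UnitaryGroup.adelic (↥(maximalRealSubfield L)) L (IsCMField.complexConj L) 1 (JW (↥(maximalRealSubfield L)) L a)) ⧸ (UnitaryGroup.toAdelic (↥(maximalRealSubfield L)) L (IsCMField.complexConj L) 1 (JW (↥(maximalRealSubfield L)) L a)).range)) (_ : IsFiniteMeasure μW)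
        (_ : SMulInvariantMeasure ↥(UnitaryGroup.adelic (↥(maximalRealSubfield L)) L (IsCMField.complexConj L) 1 (JW (↥(maximalRealSubfield L)) L a)) (↥(UnitaryGroup.adelic (↥(maximalRealSubfield L)) L (IsCMField.complexConj L) 1 (JW (↥(maximalRealSubfield L)) L a)) ⧸ (UnitaryGroup.toAdelic (↥(maximalRealSubfield L)) L (IsCMField.complexConj L) 1 (JW (↥(maximalRealSubfield L)) L a)).range) μW)
        (Ψ : piSchwartzBruhat (↥(maximalRealSubfield L)) (Fin n'))
        (hθ : MemLp (toQuotFun (adelicGroupData (↥(maximalRealSubfield L)) L (IsCMField.complexConj L) N H) fun x =>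
          (lineThetaKernelDatum L N e₁ dV hdV hdV0 μ hμ a hρ).thetaLiftFun μW Ψ (charCM ξ) (ιA x)) 2 μA),
        v = MemLp.toLp _ hθ} : Set ((adelicGroupData (↥(maximalRealSubfield L)) L (IsCMField.complexConj L) N H).L2 μA)) →
    Q.toSubmodule = ⊥ ∨ Q.toContRep.IsTopIrreducible

/-- Unfolding of `ThetaLiftFromLineIrreducible` (`Iff.rfl`). [cite: Liu2021, App. B Cor. B.6 (1) (p. 99)] [cite: Wu2013, Thm. 5.3] -/
theorem thetaLiftFromLineIrreducible_iff :
    ThetaLiftFromLineIrreducible L N H e₁ dV hdV hdV0 ιA μA μ hμ a ξ ↔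
      (letI : MeasurableSpace (↥(UnitaryGroup.adelic (↥(maximalRealSubfield L)) L (IsCMField.complexConj L) 1 (JW (↥(maximalRealSubfield L)) L a)) ⧸ (UnitaryGroup.toAdelic (↥(maximalRealSubfield L)) L (IsCMField.complexConj L) 1 (JW (↥(maximalRealSubfield L)) L a)).range) := borel _
      haveI := normal_range_toAdelic_JW L a
      ∀ Q : ContRepresentation.ClosedSubrep ((adelicGroupData (↥(maximalRealSubfield L)) L (IsCMField.complexConj L) N H).rightRegular μA),
        (Q.toSubmodule : Set ((adelicGroupData (↥(maximalRealSubfield L)) L (IsCMField.complexConj L) N H).L2 μA)) = closure (Submodule.span ℂ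
            {v : (adelicGroupData (↥(maximalRealSubfield L)) L (IsCMField.complexConj L) N H).L2 μA | ∃ (hρ : HasThetaMajorants fun
      (p : ↥(UnitaryGroup.adelic (↥(maximalRealSubfield L)) L (IsCMField.complexConj L) N (Matrix.diagonal dV)) × ↥(UnitaryGroup.adelic (↥(maximalRealSubfield L)) L (IsCMField.complexConj L) 1 (JW (↥(maximalRealSubfield L)) L a))) (Φ : piSchwartzBruhat (↥(maximalRealSubfield L)) (Fin n')) =>
        pairRep (↥(maximalRealSubfield L)) L (IsCMField.complexConj L) N 1 e₁ (Matrix.diagonal dV) (JW (↥(maximalRealSubfield L)) L a)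
          (chiSplittingLine L e₁ dV hdV hdV0 (toHeckeCharacter L μ) (isUnitary_toHeckeCharacter L μ)
            ((isOscillatorChar_toHeckeCharacter_iff μ).mpr hμ) (TW (↥(maximalRealSubfield L)) a)
            (isUnit_det_TW (↥(maximalRealSubfield L)) a) (JW (↥(maximalRealSubfield L)) L a) (JW_eq (↥(maximalRealSubfield L)) L a))
          p Φ)
        (μW : Measure (↥(UnitaryGroup.adelic (↥(maximalRealSubfield L)) L (IsCMField.complexConj L) 1 (JW (↥(maximalRealSubfield L)) L a)) ⧸ (UnitaryGroup.toAdelic (↥(maximalRealSubfield L)) L (IsCMField.complexConj L) 1 (JW (↥(maximalRealSubfield L)) L a)).range)) (_ : IsFiniteMeasure μW)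
        (_ : SMulInvariantMeasure ↥(UnitaryGroup.adelic (↥(maximalRealSubfield L)) L (IsCMField.complexConj L) 1 (JW (↥(maximalRealSubfield L)) L a)) (↥(UnitaryGroup.adelic (↥(maximalRealSubfield L)) L (IsCMField.complexConj L) 1 (JW (↥(maximalRealSubfield L)) L a)) ⧸ (UnitaryGroup.toAdelic (↥(maximalRealSubfield L)) L (IsCMField.complexConj L) 1 (JW (↥(maximalRealSubfield L)) L a)).range) μW)
        (Ψ : piSchwartzBruhat (↥(maximalRealSubfield L)) (Fin n'))
        (hθ : MemLp (toQuotFun (adelicGroupData (↥(maximalRealSubfield L)) L (IsCMField.complexConj L) N H) fun x =>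
          (lineThetaKernelDatum L N e₁ dV hdV hdV0 μ hμ a hρ).thetaLiftFun μW Ψ (charCM ξ) (ιA x)) 2 μA),
        v = MemLp.toLp _ hθ} : Set ((adelicGroupData (↥(maximalRealSubfield L)) L (IsCMField.complexConj L) N H).L2 μA)) →
        Q.toSubmodule = ⊥ ∨ Q.toContRep.IsTopIrreducible) :=
  Iff.rfl

end Literature.NumberTheory.Automorphic.Liu2021

end
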